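import Summits.BirchSwinnertonDyer.BirchSwinnertonDyer.Theorems.BiquadraticEisensteinDescentHeegnerTwistCouplingInSupplyRoundingPinCellData
import Literature.NumberTheory.EllipticCurves.Rank1Residual.Predicates
import HarnessLib

set_option linter.dupNamespace false -- `Summit.BirchSwinnertonDyer.BirchSwinnertonDyer.Theorems.…` (summit = sub)
set_option autoImplicit false

/-!
# Crux `HeegnerTwistCouplingInSupply` (stmt-BirchSwinnertonDyer-21381) RESTRICTED TO THE FAMILY `{E_n : n prime, n ≡ 7 (mod 8)}`
# — the crux body VERBATIM, with `W := E_n`, is a theorem modulo Burungale–Tian only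

Route `BiquadraticEisensteinDescent` (cell `pub/bsd-wall`, width seat `bsd-wall-cm-bed-w2` g13; `--supports` 21381, helper). Bookkeeping sequel of
`…RoundingPinCellData.cruxOnEpCornerAllP_of_BT` (the `E_p` corner for EVERY prime `p ≡ 7 (mod 8)`). The route decl
`Summit.…Theses.BiquadraticEisensteinDescent.HeegnerTwistCouplingInSupply` reads: for every `W` (elliptic, globally minimal, `N_W ≠ 0`) and
every prime `p` with `W.HasCM`, `r_an(W) = 1`, `5 ≤ p`, `CMInert W p`, `¬ Good W p`, IF for every bound `B` there is a Heegner field of `N_W` with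
`B < |d|`, `4 < |d|`, `p ∤ h`, THEN there is one with `L(W^{(d)}, 1) ≠ 0` as well. This file proves that statement with ONE extra hypothesis,
`W = E_n` for a prime `n ≡ 7 (mod 8)` — and uses none of the others: for `W = E_n` the bad primes are `2` and `n`
(`hasGoodReductionAtPrime_congruentNumberCurve`), so `¬ Good W p ∧ 5 ≤ p` forces `p = n`, and the conclusion is `cruxOnEpCornerAllP_of_BT`
at `n`. Statements:

* `eq_of_not_good_congruentNumberCurve` — `¬ Good E_n p`, `5 ≤ p`, `n` an odd prime ⇒ `p = n`;
* ★★ `heegnerTwistCouplingInSupply_congruentNumberCurve` — the crux body for `W := E_n`, `n` prime `≡ 7 (mod 8)`, every `p`;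
* ★★ `heegnerTwistCouplingInSupply_of_eq_congruentNumberCurve` — the crux body for every `W` with `∃ n, n.Prime ∧ n % 8 = 7 ∧ W = E_n`.
* Appendix ★★ `heegnerTwistCouplingInSupply_of_eq_congruentNumberCurve_two_mul` — the crux body for every `W = E_{2n}`, `n` prime `≡ 3 (mod 4)`,
  modulo the THREE descent facts of `…CornersThreeFacts.cruxOnE2pCorner_of_three_facts` (Monsky even, Burungale–Tian, Burungale–Flach).

Both modulo Burungale–Tian's rank-zero `2`-converse for CM curves ONLY. HONEST FRAMING: the family `{E_n}` has measure zero in «all CM `W` of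
analytic rank one»; the crux (residual C⁺ on the tail) is NOT closed; BSD is not proved by any of this. THEOREMS ONLY; the Theses module is
not imported (the body is restated with `W` instantiated, not the closed decl). Supports stmt-BirchSwinnertonDyer-21381.
-/

noncomputable section

open scoped Classical

namespace Summit.BirchSwinnertonDyer.BirchSwinnertonDyer.Theorems.BiquadraticEisensteinDescentHeegnerTwistCouplingInSupplyRoundingPinCruxOnFamily

open _root_.WeierstrassCurve Literature.NumberTheory.EllipticCurves Literature.NumberTheory.EllipticCurves.Rank1Residual
open Summit.BirchSwinnertonDyer.BirchSwinnertonDyer.Theorems.BiquadraticEisensteinDescentHeegnerTwistCouplingInSupplyRoundingPinCellData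
  (cruxOnEpCornerAllP_of_BT)

/-- **The only bad prime `≥ 5` of `E_n` is `n`**: for an odd prime `n` and a prime `p ≥ 5` of bad reduction of `E_n : y² = x³ − n²x`, `p = n`
(`E_n` has good reduction at every prime not dividing `2n`). [cite: SilvermanAEC2009, VII.5 Prop. 5.1(a)] -/
theorem eq_of_not_good_congruentNumberCurve {n p : ℕ} [Fact p.Prime] (hn : n.Prime) (h5 : 5 ≤ p)
    (hbad : ¬ Good (congruentNumberCurve n) p) : p = n := by
  have hp : p.Prime := Fact.out
  by_contra hne
  refine hbad (hasGoodReductionAtPrime_congruentNumberCurve fun hdvd => ?_)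
  rcases (Nat.Prime.dvd_mul hp).mp hdvd with h2 | h
  · have := (Nat.prime_dvd_prime_iff_eq hp Nat.prime_two).mp h2
    omega
  · exact hne ((Nat.prime_dvd_prime_iff_eq hp hn).mp h)

/-- ★★ **THE CRUX BODY ON `W := E_n`, `n` prime `≡ 7 (mod 8)`, ONE NAMED FACT.** For every prime `p` and all the crux's hypotheses on
`(E_n, p)` (CM, analytic rank one, `5 ≤ p`, `p` CM-inert and bad, Heegner fields of `N(E_n)` with `p ∤ h` beyond every bound): a Heegner field `K′`
of `N(E_n)` with `4 < |d_{K′}|`, `L(E_n^{(d_{K′})}, 1) ≠ 0` and `p ∤ h(K′)` — modulo Burungale–Tian ONLY. Only `¬ Good` and `5 ≤ p` are used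
(`p = n`); the rest is `cruxOnEpCornerAllP_of_BT`. [cite: BurungaleTian2026, Thm. 1.1] [cite: Oesterle1988Gauss, II §3 Proposition p. 57 (27)] -/
theorem heegnerTwistCouplingInSupply_congruentNumberCurve
    (hBT : burungaleTian_analyticRank_eq_zero_of_selmerCorank_eq_zero_of_hasCM) {n : ℕ} (hn : n.Prime) (hn8 : n % 8 = 7) :
    ∀ (p : ℕ) [Fact p.Prime] [(congruentNumberCurve n).IsElliptic] [(congruentNumberCurve n).IsGloballyMinimal]
      [NeZero ((congruentNumberCurve n).conductorNorm ℤ)],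
      (congruentNumberCurve n).HasCM → (congruentNumberCurve n).analyticRank = 1 → 5 ≤ p →
      CMInert (congruentNumberCurve n) p → ¬ Good (congruentNumberCurve n) p →
      (∀ B : ℕ, ∃ (K : Type) (_ : Field K) (_ : NumberField K), IsImaginaryQuadratic K ∧ B < (NumberField.discr K).natAbs ∧
        4 < (NumberField.discr K).natAbs ∧ SatisfiesHeegnerHypothesis ((congruentNumberCurve n).conductorNorm ℤ) K ∧
        ¬ p ∣ NumberField.classNumber K) →
      ∃ (K : Type) (_ : Field K) (_ : NumberField K),
        IsImaginaryQuadratic K ∧ 4 < (NumberField.discr K).natAbs ∧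
        SatisfiesHeegnerHypothesis ((congruentNumberCurve n).conductorNorm ℤ) K ∧
        ((congruentNumberCurve n).quadraticTwist (NumberField.discr K : ℚ)).entireLFunction 1 ≠ 0 ∧
        ¬ p ∣ NumberField.classNumber K := by
  intro p _ _ _ _ _ _ h5 _ hbad _
  obtain rfl := eq_of_not_good_congruentNumberCurve hn h5 hbad
  obtain ⟨K, iF, iN, hK, h4, hH, hL, -, hndvd⟩ := cruxOnEpCornerAllP_of_BT hBT p hn8
  exact ⟨K, iF, iN, hK, h4, hH, hL, hndvd⟩

/-- ★★ **THE CRUX BODY FOR EVERY `W` IN THE FAMILY `{E_n : n prime, n ≡ 7 (mod 8)}`** — the universally quantified body of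
`HeegnerTwistCouplingInSupply` with the single extra hypothesis `∃ n, n.Prime ∧ n % 8 = 7 ∧ W = E_n`, modulo Burungale–Tian ONLY.
[cite: BurungaleTian2026, Thm. 1.1] [cite: Oesterle1988Gauss, II §3 Proposition p. 57 (27)] -/
theorem heegnerTwistCouplingInSupply_of_eq_congruentNumberCurve
    (hBT : burungaleTian_analyticRank_eq_zero_of_selmerCorank_eq_zero_of_hasCM) :
    ∀ (W : WeierstrassCurve ℚ) [W.IsElliptic] [W.IsGloballyMinimal] (p : ℕ) [Fact p.Prime] [NeZero (W.conductorNorm ℤ)],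
      (∃ n : ℕ, n.Prime ∧ n % 8 = 7 ∧ W = congruentNumberCurve n) →
      W.HasCM → W.analyticRank = 1 → 5 ≤ p → CMInert W p → ¬ Good W p →
      (∀ B : ℕ, ∃ (K : Type) (_ : Field K) (_ : NumberField K), IsImaginaryQuadratic K ∧ B < (NumberField.discr K).natAbs ∧
        4 < (NumberField.discr K).natAbs ∧ SatisfiesHeegnerHypothesis (W.conductorNorm ℤ) K ∧ ¬ p ∣ NumberField.classNumber K) →
      ∃ (K : Type) (_ : Field K) (_ : NumberField K),
        IsImaginaryQuadratic K ∧ 4 < (NumberField.discr K).natAbs ∧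
        SatisfiesHeegnerHypothesis (W.conductorNorm ℤ) K ∧
        (W.quadraticTwist (NumberField.discr K : ℚ)).entireLFunction 1 ≠ 0 ∧ ¬ p ∣ NumberField.classNumber K := by
  intro W _ _ p _ _ hW hCM hr h5 hinert hbad hsupply
  obtain ⟨n, hn, hn8, rfl⟩ := hW
  exact heegnerTwistCouplingInSupply_congruentNumberCurve hBT hn hn8 p hCM hr h5 hinert hbad hsupply

/-! ## Appendix — the family `{E_{2n} : n prime, n ≡ 3 (mod 4)}` (three descent facts) -/

section TwoMul

open Literature.NumberTheory.EllipticCurves.HeathBrown1994 Literature.NumberTheory.EllipticCurves.HeathBrown1994.Families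
open Summit.BirchSwinnertonDyer.BirchSwinnertonDyer.Theorems.BiquadraticEisensteinDescentHeegnerTwistCouplingInSupplyCornersThreeFacts
  (cruxOnE2pCorner_of_three_facts)

/-- **The only bad prime `≥ 5` of `E_{2n}` is `n`** (`n` an odd prime): `E_{2n}` has good reduction away from `2n`.
[cite: SilvermanAEC2009, VII.5 Prop. 5.1(a)] -/
theorem eq_of_not_good_congruentNumberCurve_two_mul {n p : ℕ} [Fact p.Prime] (hn : n.Prime) (h5 : 5 ≤ p)
    (hbad : ¬ Good (congruentNumberCurve (2 * n)) p) : p = n := by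
  have hp : p.Prime := Fact.out
  by_contra hne
  refine hbad (hasGoodReductionAtPrime_congruentNumberCurve fun hdvd => ?_)
  rcases (Nat.Prime.dvd_mul hp).mp hdvd with h2 | h
  · have := (Nat.prime_dvd_prime_iff_eq hp Nat.prime_two).mp h2
    omega
  · rcases (Nat.Prime.dvd_mul hp).mp h with h2 | h'
    · have := (Nat.prime_dvd_prime_iff_eq hp Nat.prime_two).mp h2
      omega
    · exact hne ((Nat.prime_dvd_prime_iff_eq hp hn).mp h')

/-- ★★ **THE CRUX BODY FOR EVERY `W` IN THE FAMILY `{E_{2n} : n prime, n ≡ 3 (mod 4)}`, THREE NAMED FACTS** — the body of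
`HeegnerTwistCouplingInSupply` with the single extra hypothesis `∃ n, n.Prime ∧ n % 4 = 3 ∧ W = E_{2n}`, modulo Monsky's matrix theorem (even),
Burungale–Tian and Burungale–Flach (`…CornersThreeFacts.cruxOnE2pCorner_of_three_facts`, every prime `n ≡ 3 (mod 4)`, `n ≥ 7`; here
`¬ Good ∧ 5 ≤ p` force `p = n ≥ 7`). [cite: HeathBrown1994SelmerCongruentII, Appendix (Monsky), typescript p. 41 L20–L36]
[cite: BurungaleTian2026, Thm. 1.1] [cite: BurungaleFlach2024, Thm. 1.1 and Cor. 2] -/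
theorem heegnerTwistCouplingInSupply_of_eq_congruentNumberCurve_two_mul (hM : monsky_card_selmerGroup_two_even)
    (hBT : burungaleTian_analyticRank_eq_zero_of_selmerCorank_eq_zero_of_hasCM) (hBF : bsdTriple_of_hasCM_of_L_one_ne_zero) :
    ∀ (W : WeierstrassCurve ℚ) [W.IsElliptic] [W.IsGloballyMinimal] (p : ℕ) [Fact p.Prime] [NeZero (W.conductorNorm ℤ)],
      (∃ n : ℕ, n.Prime ∧ n % 4 = 3 ∧ W = congruentNumberCurve (2 * n)) →
      W.HasCM → W.analyticRank = 1 → 5 ≤ p → CMInert W p → ¬ Good W p →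
      (∀ B : ℕ, ∃ (K : Type) (_ : Field K) (_ : NumberField K), IsImaginaryQuadratic K ∧ B < (NumberField.discr K).natAbs ∧
        4 < (NumberField.discr K).natAbs ∧ SatisfiesHeegnerHypothesis (W.conductorNorm ℤ) K ∧ ¬ p ∣ NumberField.classNumber K) →
      ∃ (K : Type) (_ : Field K) (_ : NumberField K),
        IsImaginaryQuadratic K ∧ 4 < (NumberField.discr K).natAbs ∧
        SatisfiesHeegnerHypothesis (W.conductorNorm ℤ) K ∧
        (W.quadraticTwist (NumberField.discr K : ℚ)).entireLFunction 1 ≠ 0 ∧ ¬ p ∣ NumberField.classNumber K := by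
  intro W _ _ p _ _ hW _ _ h5 _ hbad _
  obtain ⟨n, hn, hn4, rfl⟩ := hW
  obtain rfl := eq_of_not_good_congruentNumberCurve_two_mul hn h5 hbad
  obtain ⟨K, iF, iN, hK, h4, hH, hL, -, hndvd⟩ := cruxOnE2pCorner_of_three_facts hM hBT hBF p hn4 (by omega)
  exact ⟨K, iF, iN, hK, h4, hH, hL, hndvd⟩

end TwoMul

end Summit.BirchSwinnertonDyer.BirchSwinnertonDyer.Theorems.BiquadraticEisensteinDescentHeegnerTwistCouplingInSupplyRoundingPinCruxOnFamily

end
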